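import Summits.BirchSwinnertonDyer.BirchSwinnertonDyer.Theorems.SmallImageMuTransferMuTransferX9OfStepsTwoFourOdd
import Summits.BirchSwinnertonDyer.BirchSwinnertonDyer.Theorems.SmallImageMuTransferMuTransferX9KolyvaginPackage
import Summits.BirchSwinnertonDyer.Rank1Residual.GaloisImage.PropagatedConditionCardEP
import Literature.NumberTheory.GaloisCohomology.PoitouTateNumberField
import Literature.NumberTheory.EllipticCurves.Kato2004.IwasawaH1ReductionRoots
import HarnessLib

/-!
# The deciding crux `MuTransferX9` (stmt-BirchSwinnertonDyer-19276) modulo F1 ∧ F2 ONLY — F3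
# (Poitou–Tate over `ℚ`) is a tree theorem

Cell `b2b-bsdres`, unit `b2b-bsdres-x10` (= N2 class lead, GEN 40), helper for the `bsd-smallim` cell's
rung-K6 crux (`--supports stmt-BirchSwinnertonDyer-19276`).  HONEST FRAMING
(run/shared/lean/b2b/bsd-rank1-residual/, verbatim in every file): the goal of the cell is to DELETE the
COMBINATION-SHAPED residual classes of the Birch–Swinnerton-Dyer formula for analytic-rank `≤ 1` curves
over `ℚ` using PUBLISHED theorems only, and to TYPE the CONSTRUCTION-SHAPED remainder; this is not
"finishing BSD".  Theorems only: no definition, no named fact, no `sorry`; nothing asserted about any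
curve; closes NO item (the crux 19276 is unconditional and stays OPEN by design); never summit credit.
PARTITION (D-0054): X9 (A4; good-ordinary `p ∈ {5, 7}`, `ρ̄` irreducible ∧ ¬surjective) — helper toward
crux 19276; the same composition serves X10b∧¬Surj (A5) × `p = 3` through the class-free core
(`X10/CoreTheoremAOddPrimeOfFactsPT`).

## What

k6-c2's kernel composition `smallImageMuTransfer_MuTransferX9_of_stepsTwoFourOdd (hfineZ) (hred) (hPT)
(hEP) (hG34)` (p470966) reaches the route decl `MuTransferX9` BY NAME from F1 (`hfineZ`), F2 (`hred`), F3
(`hPT`), Tate's local Euler–Poincaré characteristic (`hEP`) and the registered stub `stub_stepsTwoFourOdd`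
(`hG34`).  Three of the five are TREE THEOREMS:

* F3 — `GaloisCohomology.poitouTate_sum_localTatePairing_eq_zero_holds ℚ` (cell `bsd-cn100`, p475389,
  2026-08-26T23:39Z: Tate's reciprocity law `∑_v inv_v = 0` for every number field and every level, and with
  it the nine-term sum formula; Milne ADT I Thm. 4.10 (b));
* `hEP` — `GaloisImage.EP.forall_localEulerPoincareCharacteristic_adicCompletion ℚ`;
* `hG34` — `TameClass.stub_stepsTwoFourOdd_holds` (koly g9, p474398).

Hence **`smallImageMuTransfer_MuTransferX9_of_fine_red (hfineZ) (hred) : MuTransferX9`** — the crux modulo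
F1 = `Kato2004.exists_divisibilityInputs_fineQuotient_zeta` (Kato Thm. 12.5/12.6 package with the fine
quotient and the span clause; aside 19843) and F2 = `Kato2004.mem_pSmul_of_red_eq_zero` (Kato §13.8; aside
19844, whose in-tree discharge via Lemma 8.5 (2) is in flight: k6-g4 g2 p477776
`mem_pSmul_of_red_eq_zero_of_integral_of_smul_mem`, k6-g3 g2, lur-a g2).  When F2 lands as `T : F2`, the crux
modulo F1 alone is the one-liner `smallImageMuTransfer_MuTransferX9_of_fine_red hfineZ T`; the second
theorem below, `smallImageMuTransfer_MuTransferX9_of_fine_of_integral`, already takes F2 in k6-g4 g2's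
REDUCED form (the weak Lemma 8.5 (2) statement adopted l.373/l.382 of the cell bus) so that lur-a's /
k6-g3's theorem plugs in with no adapter.

References: K. Kato, Astérisque 295 (2004) Thm. 12.5, 12.6, §13.8, Lemma 8.5, (14.9.3), §17.13
[Kato2004Asterisque]; J. S. Milne, *Arithmetic Duality Theorems* (2006) I Thm. 4.10 [MilneADT2006];
R. Greenberg, V. Vatsal, Invent. Math. 142 (2000) Prop. 3.7 [GreenbergVatsal2000]; B. Mazur, K. Rubin,
Mem. AMS 799 (2004) [MazurRubin2004].
-/

-- the summit and its single problem are both named `BirchSwinnertonDyer` (registry layout D-0017)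
set_option linter.dupNamespace false
set_option autoImplicit false

noncomputable section

open Literature.NumberTheory.GaloisRepresentations
open Literature.NumberTheory.GaloisCohomology
open Literature.NumberTheory.EllipticCurves
open Literature.NumberTheory.EllipticCurves.Kato2004
open Literature.NumberTheory.EllipticCurves.Kato2004.EulerSystemValues
open Summit.BirchSwinnertonDyer.BirchSwinnertonDyer.Rank1Residual

namespace Summit.BirchSwinnertonDyer.BirchSwinnertonDyer.Theorems

/-- **The deciding crux `MuTransferX9` (19276) from F1 ∧ F2 alone**: Kato's μ-transfer on class X9 (a
`p`-adic unit coefficient of `L_p(f, α, T)` forces `μ(X(E/ℚ_∞)) = 0` at good ordinary irreducible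
non-surjective `p ∈ {5, 7}`) — k6-c2's `smallImageMuTransfer_MuTransferX9_of_stepsTwoFourOdd` with F3
supplied by the tree theorem `poitouTate_sum_localTatePairing_eq_zero_holds ℚ`, Tate's local Euler–Poincaré
characteristic by `GaloisImage.EP.forall_localEulerPoincareCharacteristic_adicCompletion ℚ` and the stub by
`TameClass.stub_stepsTwoFourOdd_holds`.  Conclusion: the route decl BY NAME; nothing asserted.
[cite: Kato2004Asterisque, Thm. 12.5, Thm. 12.6, §13.8, (14.9.3), §17.13]
[cite: MilneADT2006, Ch. I, Thm. 4.10(b)] [cite: GreenbergVatsal2000, Prop. 3.7] -/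
theorem smallImageMuTransfer_MuTransferX9_of_fine_red
    (hfineZ : exists_divisibilityInputs_fineQuotient_zeta) (hred : mem_pSmul_of_red_eq_zero) :
    Summit.BirchSwinnertonDyer.BirchSwinnertonDyer.Theses.SmallImageMuTransfer.MuTransferX9 :=
  smallImageMuTransfer_MuTransferX9_of_stepsTwoFourOdd hfineZ hred
    (poitouTate_sum_localTatePairing_eq_zero_holds ℚ)
    (Summit.BirchSwinnertonDyer.Rank1Residual.GaloisImage.EP.forall_localEulerPoincareCharacteristic_adicCompletion
      ℚ)
    TameClass.stub_stepsTwoFourOdd_holds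

/-- **The deciding crux `MuTransferX9` (19276) from F1 and the WEAK Lemma 8.5 (2)** — F2 taken in the
REDUCED form of k6-g4 g2 (`Kato2004.mem_pSmul_of_red_eq_zero_of_integral_of_smul_mem`, p477776: a
norm-compatible family `z` of classes of `T_pW` along the cyclotomic layers whose `p`-multiples are integral
is integral), the statement lur-a g2 / k6-g3 g2 are proving (cell bus l.373/l.379/l.382, verbatim): their
theorem plugs into `hint` with no adapter.  Nothing asserted.
[cite: Kato2004Asterisque, §13.8 (pp. 228–229) with Lemma 8.5 (2) (p. 183)]
[cite: MilneADT2006, Ch. I, Thm. 4.10(b)] -/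
theorem smallImageMuTransfer_MuTransferX9_of_fine_of_integral
    (hfineZ : exists_divisibilityInputs_fineQuotient_zeta)
    (hint : ∀ (W : WeierstrassCurve ℚ) [W.IsElliptic] (p : ℕ) [Fact p.Prime]
      [ContinuousSMul ℤ_[p] (W.tateModule p)] (κ : ZpExtension ℚ p), κ.IsCyclotomic →
      ∀ z : ∀ n : ℕ, H1 (tateRep W p) (κ.layerSubgroup n),
        (∀ n, layerCores (tateRep W p) κ n (z (n + 1)) = z n) →
        (∀ n, (p : ℤ_[p]) • z n ∈ integralH1 (tateRep W p) p (κ.layerSubgroup n)) →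
          ∀ n, z n ∈ integralH1 (tateRep W p) p (κ.layerSubgroup n)) :
    Summit.BirchSwinnertonDyer.BirchSwinnertonDyer.Theses.SmallImageMuTransfer.MuTransferX9 :=
  smallImageMuTransfer_MuTransferX9_of_fine_red hfineZ (mem_pSmul_of_red_eq_zero_of_integral_of_smul_mem hint)

end Summit.BirchSwinnertonDyer.BirchSwinnertonDyer.Theorems

end
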